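import Mathlib
import HarnessLib
import HarnessLib.Audit
import Summits.NavierStokesRegularity.Statement
import Literature.Analysis.FluidPDE.ClassicalSolution
import Literature.Analysis.FluidPDE.LerayHopf
import Literature.Analysis.FluidPDE.NSWave0
import Literature.Analysis.FluidPDE.SelfSimilar
import Literature.Analysis.FluidPDE.LocalTypeI
import Literature.Analysis.FluidPDE.VectorCalculus
import Literature.Analysis.FluidPDE.SereginSverak2002PressureLowerBound
import Literature.Analysis.FluidPDE.NSBoundedMildOseen
import Literature.Analysis.UnboundedOperators.HeatKernel
import HarnessLib.Audit.Status.Attr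

/-!
Route: LocalTraceTubeDoor

CLOSED (proved) 2026-08-27T12:03:39Z by planner-director-ns-g8-0 — reason: proved:Summit.NavierStokesRegularity.NavierStokesRegularity.Theorems.LocalTraceTubeDoorTargetClose.target_proof — note: D-0092 director close (director-ns g8): rung-leaf route; Target (= closer label LocalTubeDoorTraceSquare, rung N0-LocalTubeDoorTraceSquare) proved by nsreg-p6 g9's Theorems/LocalTraceTubeDoorTargetClose.lean (target_proof, file sha16 9b728aee5de612cb); all items born with closers (p519994 / p441522 . The file is kept as the record of this route; refuted decls are indexed as negative knowledge (`ledger negatives`).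

# Route LocalTraceTubeDoor — local Type I plus ONE similarity window on which the scale-invariant
trace-square density (T−t)² tr((Du)²) = −(T−t)²Δp fades forces regularity — harmonic pressure,
Burgers, Type-I maximum principle

RUNG-LEAF ROUTE (D-0061; leaf = the proposed rung N0-LocalTubeDoorTraceSquare of LADDER-NS = this
route's own `Target` item, the door S14 of cell nsreg-p1 ROUND-13; it does NOT claim Clay (A)). It
suffices to show X = K1 ∧ K2: (K1 `LocalPointZoomVelGradSlices`, the tree's universal first-order
zoom) at a point that is locally Type I but not backward bounded, the parabolic point zoom produces
a profile v of the Type-I class — Type I in time (‖v(t,y)‖ ≤ C/√(−t)), continuous on the open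
backward slab, unit-viscosity Oseen–Duhamel (mild) identity between negative times, divergence-free
slices, backward-singular at the apex, with velocities AND velocity gradients converging on every
slice along one sequence of scales; (K2 `TraceSquareProfileRigidity`) such a profile on which
tr((Dv(s))²) = 0 on every slice (⇔ its canonical pressure is harmonic on every slice) is NOT
backward-singular (in fact v ≡ 0). The two supports carry the door hypothesis across the zoom
(`TargetOfWindow`: L¹-fading of the continuous scale-invariant density on the physical window ⇒ by
Fatou the limit density vanishes on the window √(−s)·U of every slice) and spread the window to the
slice (`WindowOfProfile`: slice real-analyticity). BORN-WITH-CLOSERS: every item text is nsreg-p6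
g9's LANDED theorem verbatim (K2/supports:
`Summit.NavierStokesRegularity.NavierStokesRegularity.Theorems.LocalTraceTubeDoorProfileRigidity.traceSquareProfileRigidity
/ traceSquareWindowRigidity / windowOfProfile`, p519994; leaf and assembly:
`Summit.NavierStokesRegularity.NavierStokesRegularity.Theorems.LocalTraceTubeDoorTarget.target /
assembly`, p520765; K1:
`Summit.NavierStokesRegularity.NavierStokesRegularity.Theorems.LocalSineTubeDoorLocalPointZoomGradSlices.localPointZoomVelGradSlices`,
p441522) — kit bc/S14Items.lean (rc 0, 0 sorry) closes all seven by `exact`, so the door closes at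
birth.
Lean:
`Summit.NavierStokesRegularity.NavierStokesRegularity.Theses.LocalTraceTubeDoor.LocalPointZoomVelGradSlices
∧
Summit.NavierStokesRegularity.NavierStokesRegularity.Theses.LocalTraceTubeDoor.TraceSquareProfileRigidity`

## Assembly
The deciding theorem `closes (h₁ : LocalPointZoomVelGradSlices) (h₂ : TraceSquareProfileRigidity)
(h₃ : WindowOfProfile) (h₄ : TargetOfWindow) : Target := h₄ h₁ (h₃ h₂)` (glue.lean; logic only, no
Theorems import in the route file, certified by `ledger route check --native`; kernel-checked with
all closers in bc/S14Items.lean `target_holds`). All four binders are consumed; every binder is a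
landed theorem (BC6: the leaf `Target` is the conclusion of `closes` and becomes `aside` at birth;
the Assembly item is schema-required and exempt).

CLOSES_TARGET: closes rung N0-LocalTubeDoorTraceSquare of NavierStokesRegularity: Summit.NavierStokesRegularity.NavierStokesRegularity.Theses.LocalTraceTubeDoor.Target (D-0061; not the summit Statement) — the deciding theorem of this route concludes that registered leaf instead of the Statement decl `NavierStokesRegularity` (class rung: servable and labelled, never counted as concluding the summit Statement).

Rationale: WHY THIS LINE. The cell's doors read LOCAL observables of ONE point's similarity windows under the
local Type-I bound — vorticity direction (S10–S13), vorticity support (S15), helicity (S11), strain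
(S16 family), pressure profile (S17⁺); S14 is the PRESSURE-HESSIAN-TRACE member: the observable is
the second invariant of the velocity gradient tr((Du)²) = |S|² − ½|ω|² = −Δp (the Q-criterion
density), LOCAL and first order in u, and the residue class is «Type-I profiles whose canonical
pressure is harmonic on every slice». Mechanism of K2 (p6 g9, p519994): pressure Poisson + the
harmonic mean-value GRADIENT formula at scale R + the class's large-scale pressure-oscillation bound
(F1, `exists_integral_abs_sub_le_class` — this is where the Oseen–Duhamel clause is consumed: the
parasitic v = a(t), p = −a′(t)·x has harmonic pressure and a singular apex but is not mild) ⇒ ∇p ≡ 0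
⇒ the profile is an ancient bounded solution of viscous vector BURGERS ⇒ |v|² is a bounded
sub-solution of the drift–heat equation ⇒ whole-space maximum principle
(`le_of_bounded_subsolution`, p458511) + the Type-I rate as s → −∞ ⇒ v ≡ 0. The fine structure used
is the exact nonlinearity's pressure law Δp = −tr((Du)²) slice by slice, which the averaged equation
does not possess. What is imported: the KNSS/Seregin–Šverák zoom-door template
(KochNadirashviliSereginSverak2009, SereginSverak2009; tree `localPointZoomVelGradSlices` +
`genericDoor_of_profileWindowRigidity` with F(x,A) = tr(A∘A)), slice analyticity of Oseen-mild
Type-I profiles, the drift–heat maximum principle.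

RANKED CRUXES. #0 Target (target) — the leaf (door S14): a classical NS solution on [0,T),
Leray–Hopf from a rapidly decaying datum, locally Type I at (x₀,T) in the ESS sense
(‖u(t,x)‖√(ν(T−t)) ≤ M on B(x₀,ρ) × (T−ρ²,T)), such that the scale-invariant trace-square density
(T−t)² tr((Du(t))²)(x₀ + √(T−t)·y) fades in L¹ over ONE nonempty open similarity window U as t → T⁻,
is backward bounded at x₀ («Type-I blow-up needs a non-harmonic pressure at the blow-up scale»).
(why it might fail: it cannot as typed — PROVED (p520765 `…LocalTraceTubeDoorTarget.target`, text
verbatim); residual risk = interest: no known blow-up scenario or model has an asymptotically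
harmonic pressure on a similarity window.) [SereginSverak2002, KochNadirashviliSereginSverak2009,
SereginSverak2009, EscauriazaSereginSverak2003, Tsai1998, Chae2012PressureIntegrals, TranYu2016]
#2 TraceSquareProfileRigidity (crux) — TRACE-SQUARE PROFILE RIGIDITY (K2, the residue): let v be a
profile v of the Type-I class — Type I in time (‖v(t,y)‖ ≤ C/√(−t)), continuous on the open backward
slab, unit-viscosity Oseen–Duhamel (mild) identity between negative times, divergence-free slices,
with tr((Dv(s))(y) ∘ (Dv(s))(y)) = 0 for every y of every slice s < 0 (⇔ harmonic canonical
pressure); then v is not backward-singular at the apex (0,0) (in fact v ≡ 0). [difficulty: S] (why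
it might fail: it cannot as typed — PROVED by nsreg-p6 g9:
`…Theorems.LocalTraceTubeDoorProfileRigidity.traceSquareProfileRigidity` (p519994, verbatim);
WITHOUT the mild clause it is false (v = a(t), p = −a′(t)·x) — the clause is in the class.)
[SereginSverak2002, KochNadirashviliSereginSverak2009, SereginSverak2009,
EscauriazaSereginSverak2003, Tsai1998, Chae2012PressureIntegrals, TranYu2016]
#3 LocalPointZoomVelGradSlices (crux) — LOCAL POINT ZOOM (K1, the tree's universal first-order
zoom): under the leaf's hypotheses and ¬ backward bounded at x₀ there are C, a profile v of the
Type-I class — Type I in time (‖v(t,y)‖ ≤ C/√(−t)), continuous on the open backward slab,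
unit-viscosity Oseen–Duhamel (mild) identity between negative times, divergence-free slices,
backward-singular at (0,0), and scales λⱼ ↓ 0 along which the rescaled velocities (λⱼ/ν)u(T+λⱼ²s/ν,
x₀+λⱼy) → v(s,y) and gradients (λⱼ²/ν)Du(…) → Dv(s)(y) at every (s,y), s < 0. [difficulty: S] (why
it might fail: it cannot as typed — it IS the tree theorem
`…Theorems.LocalSineTubeDoorLocalPointZoomGradSlices.localPointZoomVelGradSlices` (p441522) verbatim
(Sketch13 control `localPointZoomVelGradSlices_holds`); filed as the route's zoom half so the rung
records its closer.) [KochNadirashviliSereginSverak2009, SereginSverak2009,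
EscauriazaSereginSverak2003]
#9 TraceSquareWindowRigidity (support) — the WINDOW form of K2: a profile of the class whose
trace-square density vanishes on SOME nonempty open window of every slice s < 0 is not
backward-singular at the apex (⇐ K2 by slice real-analyticity; PROVED p519994
`…traceSquareWindowRigidity`, verbatim). [difficulty: S] [SereginSverak2002,
KochNadirashviliSereginSverak2009, SereginSverak2009, EscauriazaSereginSverak2003, Tsai1998,
Chae2012PressureIntegrals, TranYu2016]
#9 WindowOfProfile (support) — window ⇐ profile: TraceSquareProfileRigidity →
TraceSquareWindowRigidity (spreading by slice analyticity; PROVED p519994 `…windowOfProfile`,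
verbatim — in fact the window form holds outright). [deps: TraceSquareProfileRigidity,
TraceSquareWindowRigidity] [difficulty: S] [SereginSverak2002, KochNadirashviliSereginSverak2009,
SereginSverak2009, EscauriazaSereginSverak2003, Tsai1998, Chae2012PressureIntegrals, TranYu2016]
#9 TargetOfWindow (support) — the door reduction: LocalPointZoomVelGradSlices →
TraceSquareWindowRigidity → Target (the L¹-fading hypothesis on the physical window becomes, slice
by slice along the zoom, vanishing of the continuous limit density tr((Dv(s))²) on the window
√(−s)·U by Fatou + pointwise convergence of Du; PROVED: `fun _ _ =>
Summit.NavierStokesRegularity.NavierStokesRegularity.Theorems.LocalTraceTubeDoorTarget.target`,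
p520765, whose proof is exactly this reduction via `genericDoor_of_profileWindowRigidity`). [deps:
LocalPointZoomVelGradSlices, TraceSquareWindowRigidity, Target] [difficulty: S] [SereginSverak2002,
KochNadirashviliSereginSverak2009, SereginSverak2009, EscauriazaSereginSverak2003, Tsai1998,
Chae2012PressureIntegrals, TranYu2016]

TWO-LAYER PLAN. None foreseen: every binder closes at birth from a landed theorem (K2/supports
p519994, leaf/assembly p520765, K1 p441522). If the gate's dedup attaches an existing item to a decl
(K1's text is shared with route LocalLambTubeDoor's `LocalPointZoomVelGradSlices`), the closer is
the same constant.

KILL CRITERIA. As typed nothing can refute the items (all are theorems); the route is closed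
`--reason proved` once p6 lands `Theorems/LocalTraceTubeDoorTargetClose.lean` (`theorem target_proof
: Summit.NavierStokesRegularity.NavierStokesRegularity.Theses.LocalTraceTubeDoor.Target :=
Summit.NavierStokesRegularity.NavierStokesRegularity.Theorems.LocalTraceTubeDoorTarget.target`). The
DOOR (the rung's interest) would be retired as vacuous only by a theorem showing that L¹-fading of
(T−t)²Δp on a similarity window already implies an averaged-class (Prodi–Serrin / ESS /
Seregin–Šverák one-sided pressure) condition — not expected: the observable is a scale-invariant
density on one window of one point, not a norm or a one-sided bound of p on ℝ³.

NOT DECOMPOSED YET. Nothing: every item is a single landed theorem. The sequel doors p6 g9 proved on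
the same engine (isobaric window p523397/p525375, reusing S17⁺'s K1 20181; harmonic head
p524688/p525812, second-order zoom) are separate leaves with their own closer labels and are NOT
items of this route.

CHEAPEST FALSIFIER. The parasitic stratum v(s,y) = a(s) (constant in space, |a(s)| ≤ C/√(−s), |a| →
∞), p = −a′(s)·y: harmonic pressure, singular apex — it violates the Oseen–Duhamel clause
(heatExtension of a constant is the constant, oseenDuhamel of a constant tensor vanishes), so it is
NOT in the class; this is the refuter's Day-1 check of ROUND-13 §4 and the reason (F1) is
load-bearing in p6's proof. The exactly self-similar stratum is NRŠ/Tsai (tree), lever idle. Since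
every item is PROVED, no falsifier of the items exists; the cheapest check of the door's INTEREST is
whether any blow-up scenario/model has asymptotically harmonic pressure (Q ≡ 0: strain and rotation
rates balanced pointwise) on a similarity window — none known (Q-criterion DNS literature identifies
vortices by Q > 0 cores and Q < 0 sheaths, never Q → 0 on an open set at the singular scale).

NUMBERS. Door-class constant C (Type-I time rate of the zoom profile, C = M/√ν-normalised);
similarity radius of a zoom point y at profile time s is ‖y‖/√(−s); the observable's scaling weight
(T−t)² (tr((bA)²) = b² tr(A²), `trace_smul_comp_smul`); (F1) pressure-oscillation scale r ≥ 1 in the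
harmonic mean-value gradient formula; maximum-principle comparison sup|v(t)|² ≤ sup|v(s)|² ≤ C²/(−s)
→ 0 as s → −∞.

DEFINITION REQUESTS. None — every constant exists:
Literature.Analysis.FluidPDE.{IsClassicalNSSolutionOn, IsLerayHopfOn, HasRapidSpatialDecay,
IsBackwardBoundedAt, HasTypeITimeDecay, IsBackwardSingularPoint, oseenDuhamel,
VectorCalculus.IsDivFree}, Literature.Analysis.UnboundedOperators.heatExtension, Mathlib
LinearMap.trace / fderiv / lintegral / ENNReal.ofReal; the observable is spelled inline (no defs in
items), exactly as in p6's landed theorems.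

Novelty: Searches (seat nsreg-p1 g11, 2026-08-26/27, recorded in HOME/ns-regularity-ideate-p1/ROUND-13.md §6;
both corpora, labels per BC8): `lit search --hybrid "regularity criterion Navier-Stokes pressure
lower bound blow-up Seregin Sverak"` → 8 docs (Seregin 2014 notes pp.169–174 bibliography only,
checked with `lit read --grep`; Robinson–Rodrigo–Sadowski 2016; Lemarié-Rieusset 2016) — no
statement of S14's type [corpus: null for the statement]; `lit vsearch` of the S14 prose → textbooks
only; `lit search "Navier-Stokes equations with lower bounds on the pressure"` → 6 local docs, all
citing Seregin–Šverák 2002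
[corpus:book:robinson2016-three-dimensional-navier-stokes-equations-classical-theory p.341]; `lit
search "pressure moderation Navier-Stokes Tran Yu"` → [corpus:paper:doi-10-1016-j-aml-2016-10-006
pp.6–7]; `lit galaxy search "lower bounds on the pressure|pressure moderation|Q-criterion" --star
all -n 12` → 26 rows: panama 12 (none mathematical), pdf 12 (Q-criterion = vortex-identification DNS
papers, no regularity theory), crabby 2 [galaxy: null for the statement]; presearch of the residue
lemma «harmonic pressure on slices ⇒ trivial Type-I ancient mild solution»: `lit search --hybrid
"Navier-Stokes harmonic pressure Liouville theorem bounded ancient solution constant" -n 8` →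
textbooks (Seregin 2014 pp.111–129; RRS 2016; LR 2016 pp.460/487/800) [corpus: null]; `lit galaxy
search "harmonic pressure|pressure is harmonic|Δp = 0" --star all -n 10` → 22 rows, none
mathematical [g  [refs: book:robinson2016-three-dimensional-navier-stokes-equations-classical-theory, paper:doi-10-1016-j-aml-2016-10-006, paper:arxiv-1110.3631, KochNadirashviliSereginSverak2009, SereginSverak2009]

Barriers (technique_class: pressure-hessian-trace, similarity-zoom, profile-liouville): - technique_class: pressure-hessian-trace, similarity-zoom, profile-liouville
- Literature.Barriers.NavierStokesRegularity.TaoAveragedBlowup: OUTSIDE its class — K2 uses the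
exact pressure law Δp = −tr((Du)²) = −∂ᵢuⱼ∂ⱼuᵢ slice-wise and the canonical (Oseen–Duhamel) pressure
of the TRUE bilinear form; the averaged bilinear form has no pointwise pressure-Hessian identity;
the door excludes nothing unconditionally (a criterion, Tao's category (2) «a hypothesis on the
solution») [corpus:paper:arxiv-1402.0290 §1.3].
- Literature.Barriers.NavierStokesRegularity.AveragedTypeIBlowup: same placement — Type-I exclusion
is asserted only under the window hypothesis, which is not averaging-insensitive.
- Literature.Barriers.NavierStokesRegularity.EnergySupercriticality: CONSISTENT, not beaten — every
hypothesis is scale-invariant (critical): local Type I and the weight (T−t)² on tr((Du)²) at the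
similarity scale.
- Literature.Barriers.NavierStokesRegularity.LeraySelfSimilarBlowupExclusion: CONSISTENT — the
exactly self-similar stratum of K2 is NecasRuzickaSverak1996/Tsai1998 (tree
ControlsClassLevel.typeI_ancient_selfSimilar_ae_zero), lever idle there; K2's content is the general
Type-I class profile.
- Literature.Barriers.NavierStokesRegularity.NearOneDssTypeIExclusion: CONSISTENT, not threatened —
the DSS stratum is decided for EVERY factor λ by the same maximum-principle argument (sup|v|²
non-increasing and → 0 at −∞), no nearness to 1 used.
- Literature.Barriers.NavierStokesRegularity

History (route lifecycle, newest last):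
- 2026-08-27T11:43:16Z · closes_target -> closes rung N0-LocalTubeDoorTraceSquare of NavierStokesRegularity: Summit.NavierStokesRegularity.NavierStokesRegularity.Theses.LocalTraceTubeDoor.Target (D-0061; not the summit Statement) (planner-director-ns-g8-0)
- 2026-08-27T12:03:40Z · CLOSED proved — proved:Summit.NavierStokesRegularity.NavierStokesRegularity.Theorems.LocalTraceTubeDoorTargetClose.target_proof (planner-director-ns-g8-0)

sub-problem: NavierStokesRegularity · status: closed(proved) · opened planner-director-ns-g8-0 2026-08-27T11:20:37Z · rev 2 · ledger route-NavierStokesRegularity-LocalTraceTubeDoor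
GENERATED by the gate from the ledger (D-0016/17). Provers cite these decls: `theorem foo : Summit.NavierStokesRegularity.NavierStokesRegularity.Theses.LocalTraceTubeDoor.<Decl> := …` in Summits/NavierStokesRegularity/NavierStokesRegularity/Theorems/<Name>.lean.
-/

namespace Summit.NavierStokesRegularity.NavierStokesRegularity.Theses.LocalTraceTubeDoor

open scoped BigOperators Topology Manifold Classical MeasureTheory ProbabilityTheory Matrix InnerProductSpace ComplexConjugate ContinuousMap
open Filter Set Function TopologicalSpace MeasureTheory

attribute [summit_statement] _root_.NavierStokesRegularity
-- H21.Audit: the closer leaf Summit.NavierStokesRegularity.NavierStokesRegularity.Theses.LocalTraceTubeDoor.Target is an item decl of this route file — tagged summit_statement below, after its declaration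

open Literature.NS

/-- item stmt-NavierStokesRegularity-20412 · crux · rank 0 · closed · proved by Summit.NavierStokesRegularity.NavierStokesRegularity.Theorems.LocalTraceTubeDoorTargetClose.target_proof (prover) · by planner
why it might fail: it cannot as typed — PROVED (p520765 `…LocalTraceTubeDoorTarget.target`, text verbatim); residual risk = interest: no known blow-up scenario or model has an asymptotically harmonic pressure on a similarity window.
sources: SereginSverak2002, KochNadirashviliSereginSverak2009, SereginSverak2009, EscauriazaSereginSverak2003, Tsai1998, Chae2012PressureIntegrals
[target] the leaf (door S14): a classical NS solution on [0,T), Leray–Hopf from a rapidly decaying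
datum, locally Type I at (x₀,T) in the ESS sense (‖u(t,x)‖√(ν(T−t)) ≤ M on B(x₀,ρ) × (T−ρ²,T)), such
that the scale-invariant trace-square density (T−t)² tr((Du(t))²)(x₀ + √(T−t)·y) fades in L¹ over
ONE nonempty open similarity window U as t → T⁻, is backward bounded at x₀ («Type-I blow-up needs a
non-harmonic pressure at the blow-up scale»). -/
@[route_item "route-NavierStokesRegularity-LocalTraceTubeDoor"]
def Target : Prop :=
  ∀ (ν T : ℝ), 0 < ν → 0 < T → ∀ (u : ℝ → EuclideanSpace ℝ (Fin 3) → EuclideanSpace ℝ (Fin 3)) (p : ℝ → EuclideanSpace ℝ (Fin 3) → ℝ), Literature.Analysis.FluidPDE.IsClassicalNSSolutionOn (Set.Ico 0 T) ν 0 u p → Literature.Analysis.FluidPDE.IsLerayHopfOn T ν 0 (u 0) u → Literature.Analysis.FluidPDE.HasRapidSpatialDecay (u 0) → ∀ (x₀ : EuclideanSpace ℝ (Fin 3)) (ρ M : ℝ), 0 < ρ → (∀ t ∈ Set.Ico 0 T, T - ρ ^ 2 < t → ∀ x ∈ Metric.ball x₀ ρ, ‖u t x‖ * Real.sqrt (ν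 * (T - t)) ≤ M) → ∀ (U : Set (EuclideanSpace ℝ (Fin 3))), IsOpen U → U.Nonempty → Filter.Tendsto (fun t => ∫⁻ y in U, ENNReal.ofReal |(T - t) ^ 2 * LinearMap.trace ℝ (EuclideanSpace ℝ (Fin 3)) (((fderiv ℝ (u t) (x₀ + Real.sqrt (T - t) • y)).comp (fderiv ℝ (u t) (x₀ + Real.sqrt (T - t) • y))) : EuclideanSpace ℝ (Fin 3) →ₗ[ℝ] EuclideanSpace ℝ (Fin 3))|) (nhdsWithin T (Set.Iio T)) (nhds 0) → Literature.Analysis.FluidPDE.IsBackwardBoundedAt u T x₀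

-- `Target` holds: proved by `Summit.NavierStokesRegularity.NavierStokesRegularity.Theorems.LocalTraceTubeDoorTargetClose.target_proof` (its module imports this route file, so no `_holds` link can be stated here).

/-- item stmt-NavierStokesRegularity-20413 · crux · rank 2 · closed · proved by Summit.NavierStokesRegularity.NavierStokesRegularity.Theorems.LocalTraceTubeDoorK2Close.k2_proof (prover) · by planner
why it might fail: it cannot as typed — PROVED by nsreg-p6 g9: `…Theorems.LocalTraceTubeDoorProfileRigidity.traceSquareProfileRigidity` (p519994, verbatim); WITHOUT the mild clause it is false (v = a(t), p = −a′(t)·x) — the clause is in the class.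
sources: SereginSverak2002, KochNadirashviliSereginSverak2009, SereginSverak2009, EscauriazaSereginSverak2003, Tsai1998, Chae2012PressureIntegrals
[crux] TRACE-SQUARE PROFILE RIGIDITY (K2, the residue): let v be a profile v of the Type-I class —
Type I in time (‖v(t,y)‖ ≤ C/√(−t)), continuous on the open backward slab, unit-viscosity
Oseen–Duhamel (mild) identity between negative times, divergence-free slices, with tr((Dv(s))(y) ∘
(Dv(s))(y)) = 0 for every y of every slice s < 0 (⇔ harmonic canonical pressure); then v is not
backward-singular at the apex (0,0) (in fact v ≡ 0). [difficulty: S] -/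
@[route_item "route-NavierStokesRegularity-LocalTraceTubeDoor", crux]
def TraceSquareProfileRigidity : Prop :=
  ∀ (C : ℝ) (v : ℝ → EuclideanSpace ℝ (Fin 3) → EuclideanSpace ℝ (Fin 3)), Literature.Analysis.FluidPDE.HasTypeITimeDecay C v → ContinuousOn (Function.uncurry v) (Set.Iio (0 : ℝ) ×ˢ Set.univ) → (∀ s t : ℝ, s < t → t < 0 → ∀ x, v t x = Literature.Analysis.UnboundedOperators.heatExtension (v s) (t - s) x - Literature.Analysis.FluidPDE.oseenDuhamel 1 s v v t x) → (∀ t < 0, Literature.Analysis.FluidPDE.VectorCalculus.IsDivFree (v t)) → (∀ s < 0, ∀ y : EuclideanSpace ℝ (Fin 3), LinearMap.trace ℝ (EuclideanSpace ℝ (Fin 3)) (((fderiv ℝ (v s) y).comp (fderiv ℝ (v s) y)) : EuclideanSpace ℝ (Fin 3) →ₗ[ℝ] EuclideanSpace ℝ (Fin 3)) = 0) → ¬ Literature.Analysis.FluidPDE.IsBackwardSingularPoint v 0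

-- `TraceSquareProfileRigidity` holds: proved by `Summit.NavierStokesRegularity.NavierStokesRegularity.Theorems.LocalTraceTubeDoorK2Close.k2_proof` (its module imports this route file, so no `_holds` link can be stated here).

/-- item stmt-NavierStokesRegularity-20414 · crux · rank 3 · closed · proved by Summit.NavierStokesRegularity.NavierStokesRegularity.Theorems.LocalTraceTubeDoorK1Close.k1_proof (prover) · by planner
why it might fail: it cannot as typed — it IS the tree theorem `…Theorems.LocalSineTubeDoorLocalPointZoomGradSlices.localPointZoomVelGradSlices` (p441522) verbatim (Sketch13 control `localPointZoomVelGradSlices_holds`); filed as the route's zoom half so the rung records its closer.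
sources: KochNadirashviliSereginSverak2009, SereginSverak2009, EscauriazaSereginSverak2003
[crux] LOCAL POINT ZOOM (K1, the tree's universal first-order zoom): under the leaf's hypotheses and
¬ backward bounded at x₀ there are C, a profile v of the Type-I class — Type I in time (‖v(t,y)‖ ≤
C/√(−t)), continuous on the open backward slab, unit-viscosity Oseen–Duhamel (mild) identity between
negative times, divergence-free slices, backward-singular at (0,0), and scales λⱼ ↓ 0 along which
the rescaled velocities (λⱼ/ν)u(T+λⱼ²s/ν, x₀+λⱼy) → v(s,y) and gradients (λⱼ²/ν)Du(…) → Dv(s)(y) at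
every (s,y), s < 0. [difficulty: S] -/
@[route_item "route-NavierStokesRegularity-LocalTraceTubeDoor", crux]
def LocalPointZoomVelGradSlices : Prop :=
  ∀ (ν T : ℝ), 0 < ν → 0 < T → ∀ (u : ℝ → EuclideanSpace ℝ (Fin 3) → EuclideanSpace ℝ (Fin 3)) (p : ℝ → EuclideanSpace ℝ (Fin 3) → ℝ), Literature.Analysis.FluidPDE.IsClassicalNSSolutionOn (Set.Ico 0 T) ν 0 u p → Literature.Analysis.FluidPDE.IsLerayHopfOn T ν 0 (u 0) u → Literature.Analysis.FluidPDE.HasRapidSpatialDecay (u 0) → ∀ (x₀ : EuclideanSpace ℝ (Fin 3)) (ρ M : ℝ), 0 < ρ → (∀ t ∈ Set.Ico 0 T, T - ρ ^ 2 < t → ∀ x ∈ Metric.ball x₀ ρ, ‖u t x‖ * Real.sqrt (ν * (T - t)) ≤ M) → ¬ Literature.Analysis.FluidPDE.IsBackwardBoundedAt u T x₀ → ∃ (C : ℝ) (v : ℝ → EuclideanSpace ℝ (Fin 3) → EuclideanSpace ℝ (Fin 3)) (lam : ℕ → ℝ), (∀ j, 0 < lam j) ∧ Filter.Tendsto lam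 Filter.atTop (nhds 0) ∧ (Literature.Analysis.FluidPDE.HasTypeITimeDecay C v ∧ ContinuousOn (Function.uncurry v) (Set.Iio (0 : ℝ) ×ˢ Set.univ) ∧ (∀ s t : ℝ, s < t → t < 0 → ∀ x, v t x = Literature.Analysis.UnboundedOperators.heatExtension (v s) (t - s) x - Literature.Analysis.FluidPDE.oseenDuhamel 1 s v v t x) ∧ (∀ t < 0, Literature.Analysis.FluidPDE.VectorCalculus.IsDivFree (v t))) ∧ Literature.Analysis.FluidPDE.IsBackwardSingularPoint v 0 ∧ ∀ s < 0, ∀ y, Filter.Tendsto (fun j => (lam j / ν) • u (T + lam j ^ 2 * s / ν) (x₀ + lam j • y)) Filter.atTop (nhds (v s y)) ∧ Filter.Tendsto (fun j => (lam j ^ 2 / ν) • fderiv ℝ (u (T + lam j ^ 2 * s / ν)) (x₀ + lam j • y)) Filter.atTop (nhds (fderiv ℝ (v s) y))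

-- `LocalPointZoomVelGradSlices` holds: proved by `Summit.NavierStokesRegularity.NavierStokesRegularity.Theorems.LocalTraceTubeDoorK1Close.k1_proof` (its module imports this route file, so no `_holds` link can be stated here).

/-- item stmt-NavierStokesRegularity-20415 · support · rank 9 · closed · proved by Summit.NavierStokesRegularity.NavierStokesRegularity.Theorems.LocalTraceTubeDoorWindowClose.window_proof (prover) · by planner
sources: SereginSverak2002, KochNadirashviliSereginSverak2009, SereginSverak2009, EscauriazaSereginSverak2003, Tsai1998, Chae2012PressureIntegrals
[support] the WINDOW form of K2: a profile of the class whose trace-square density vanishes on SOME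
nonempty open window of every slice s < 0 is not backward-singular at the apex (⇐ K2 by slice
real-analyticity; PROVED p519994 `…traceSquareWindowRigidity`, verbatim). [difficulty: S] -/
@[route_item "route-NavierStokesRegularity-LocalTraceTubeDoor"]
def TraceSquareWindowRigidity : Prop :=
  ∀ (C : ℝ) (v : ℝ → EuclideanSpace ℝ (Fin 3) → EuclideanSpace ℝ (Fin 3)), Literature.Analysis.FluidPDE.HasTypeITimeDecay C v → ContinuousOn (Function.uncurry v) (Set.Iio (0 : ℝ) ×ˢ Set.univ) → (∀ s t : ℝ, s < t → t < 0 → ∀ x, v t x = Literature.Analysis.UnboundedOperators.heatExtension (v s) (t - s) x - Literature.Analysis.FluidPDE.oseenDuhamel 1 s v v t x) → (∀ t < 0, Literature.Analysis.FluidPDE.VectorCalculus.IsDivFree (v t)) → (∀ s < 0, ∃ U : Set (EuclideanSpace ℝ (Fin 3)), IsOpen U ∧ U.Nonempty ∧ ∀ y ∈ U, LinearMap.trace ℝ (EuclideanSpace ℝ (Fin 3)) (((fderiv ℝ (v s) y).comp (fderiv ℝ (v s) y)) : EuclideanSpace ℝ (Fin 3) →ₗ[ℝ] EuclideanSpace ℝ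 (Fin 3)) = 0) → ¬ Literature.Analysis.FluidPDE.IsBackwardSingularPoint v 0

-- `TraceSquareWindowRigidity` holds: proved by `Summit.NavierStokesRegularity.NavierStokesRegularity.Theorems.LocalTraceTubeDoorWindowClose.window_proof` (its module imports this route file, so no `_holds` link can be stated here).

/-- item stmt-NavierStokesRegularity-20416 · support · rank 9 · closed · proved by Summit.NavierStokesRegularity.NavierStokesRegularity.Theorems.LocalTraceTubeDoorWindowOfProfileClose.windowOfProfile_proof (prover) · by planner
sources: SereginSverak2002, KochNadirashviliSereginSverak2009, SereginSverak2009, EscauriazaSereginSverak2003, Tsai1998, Chae2012PressureIntegrals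
[support] window ⇐ profile: TraceSquareProfileRigidity → TraceSquareWindowRigidity (spreading by
slice analyticity; PROVED p519994 `…windowOfProfile`, verbatim — in fact the window form holds
outright). [deps: TraceSquareProfileRigidity, TraceSquareWindowRigidity] [difficulty: S] -/
@[route_item "route-NavierStokesRegularity-LocalTraceTubeDoor", crux]
def WindowOfProfile : Prop :=
  TraceSquareProfileRigidity → TraceSquareWindowRigidity

-- `WindowOfProfile` holds: proved by `Summit.NavierStokesRegularity.NavierStokesRegularity.Theorems.LocalTraceTubeDoorWindowOfProfileClose.windowOfProfile_proof` (its module imports this route file, so no `_holds` link can be stated here).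

/-- item stmt-NavierStokesRegularity-20417 · support · rank 9 · closed · proved by Summit.NavierStokesRegularity.NavierStokesRegularity.Theorems.LocalTraceTubeDoorTargetOfWindowClose.targetOfWindow_proof (prover) · by planner
sources: SereginSverak2002, KochNadirashviliSereginSverak2009, SereginSverak2009, EscauriazaSereginSverak2003, Tsai1998, Chae2012PressureIntegrals
[support] the door reduction: LocalPointZoomVelGradSlices → TraceSquareWindowRigidity → Target (the
L¹-fading hypothesis on the physical window becomes, slice by slice along the zoom, vanishing of the
continuous limit density tr((Dv(s))²) on the window √(−s)·U by Fatou + pointwise convergence of Du;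
PROVED: `fun _ _ =>
Summit.NavierStokesRegularity.NavierStokesRegularity.Theorems.LocalTraceTubeDoorTarget.target`,
p520765, whose proof is exactly this reduction via `genericDoor_of_profileWindowRigidity`). [deps:
LocalPointZoomVelGradSlices, TraceSquareWindowRigidity, Target] [difficulty: S] -/
@[route_item "route-NavierStokesRegularity-LocalTraceTubeDoor", crux]
def TargetOfWindow : Prop :=
  LocalPointZoomVelGradSlices → TraceSquareWindowRigidity → Target

-- `TargetOfWindow` holds: proved by `Summit.NavierStokesRegularity.NavierStokesRegularity.Theorems.LocalTraceTubeDoorTargetOfWindowClose.targetOfWindow_proof` (its module imports this route file, so no `_holds` link can be stated here).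

/-- item stmt-NavierStokesRegularity-20418 · assembly · rank 1 · closed · proved by Summit.NavierStokesRegularity.NavierStokesRegularity.Theorems.LocalTraceTubeDoorAssemblyClose.assembly_proof (prover) · by planner
sources: SereginSverak2002, KochNadirashviliSereginSverak2009, SereginSverak2009, EscauriazaSereginSverak2003, Tsai1998, Chae2012PressureIntegrals
[assembly] LocalPointZoomVelGradSlices → TraceSquareProfileRigidity → the leaf (Target); PROVED
verbatim as
`Summit.NavierStokesRegularity.NavierStokesRegularity.Theorems.LocalTraceTubeDoorTarget.assembly`
(p520765) and through the glue as bc/S14Items.lean `target_holds`. -/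
@[route_item "route-NavierStokesRegularity-LocalTraceTubeDoor"]
def Assembly : Prop :=
  LocalPointZoomVelGradSlices → TraceSquareProfileRigidity → Target

-- `Assembly` holds: proved by `Summit.NavierStokesRegularity.NavierStokesRegularity.Theorems.LocalTraceTubeDoorAssemblyClose.assembly_proof` (its module imports this route file, so no `_holds` link can be stated here).

attribute [summit_statement] _root_.Summit.NavierStokesRegularity.NavierStokesRegularity.Theses.LocalTraceTubeDoor.Target

/-! D-0027 §2.1 — DECIDING THEOREM (planner-authored via `route open/edit --closes-file`; by planner-director-ns-g8-0 2026-08-27T11:43:16Z) — ARCHIVED: route closed (proved) 2026-08-27T12:03:39Z; kept so importers keep building: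
its hypotheses are this route's items and its conclusion the registered leaf `Summit.NavierStokesRegularity.NavierStokesRegularity.Theses.LocalTraceTubeDoor.Target` (rung N0-LocalTubeDoorTraceSquare, D-0061) (glue_lint), and it elaborates with this file. -/

@[closes "route-NavierStokesRegularity-LocalTraceTubeDoor"] theorem closes (h₁ : LocalPointZoomVelGradSlices) (h₂ : TraceSquareProfileRigidity) (h₃ : WindowOfProfile)
    (h₄ : TargetOfWindow) : Target :=
  h₄ h₁ (h₃ h₂)

end Summit.NavierStokesRegularity.NavierStokesRegularity.Theses.LocalTraceTubeDoor
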